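import Summits.AtomisticToContinuum.FouriersLaw.Theorems.CoercivePulseLinearCeilingIffAbelCeiling
import Summits.AtomisticToContinuum.FouriersLaw.Theorems.EmbeddedDrudeMourreAbelOfSpectralDensity
import Summits.AtomisticToContinuum.FouriersLaw.Theorems.EmbeddedDrudeMourreGreenKuboContinuationFilterInvariance
import Summits.AtomisticToContinuum.FouriersLaw.Theorems.LinearCeiling.Negative.LinearCeilingFalseWithoutPreservesMeasure
import Summits.AtomisticToContinuum.FouriersLaw.Theses.LatticeLandauDamping
import HarnessLib

/-!
# `CoercivePulse.LinearCeiling ⇒ LatticeLandauDamping.NoDrudeWeight` (item stmt-15383 ⇒ item stmt-14012)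

Line `SpikeLemma` of crux `CoercivePulse.LinearCeiling` (item stmt-AtomisticToContinuum-15383), lead c2, 2026-08-18.
A NEW edge of the obligation graph over landed theorems only: the diffusive upper envelope of the Helfand moment
(equivalently, by `linearCeiling_iff_abelCeiling`, the infinite-volume Abel ceiling (AC) of the summed current
autocorrelation `C_T`) KILLS THE DRUDE ATOM of every cosine-Bochner spectral measure of `C_T`:

* `measureReal_singleton_zero_le_of_abelMean_le` — pure real analysis: if `C(t) = ∫ cos(ωt) dσ(ω)` for a finite
  measure `σ` and `∫₀^∞ e^{−νt} C(t) dt ≤ B` at some `ν > 0`, then `σ{0} ≤ B·ν` (Fubini: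
  `∫₀^∞ e^{−νt} C = ∫ ν/(ν²+ω²) dσ ≥ σ{0}/ν`, the Poisson kernel being `1/ν` at `ω = 0`);
* `measure_singleton_zero_eq_zero_of_abelCeiling` — an Abel ceiling on `(0, ν₀)` forces `σ{0} = 0`;
* `noDrudeWeight_of_abelCeiling`, `noDrudeWeight_of_linearCeiling` — for the pinned anharmonic chain: the state of
  `NoDrudeWeight` is shift-invariant, hence (DLR uniqueness + superstability) momentum-reversal invariant
  (`Negative.map_reversal_eq_of_gibbs_shiftInvariant`), so (AC) applies to it.

So closing stmt-15383 closes stmt-14012, and `LinearCeiling` sits between the window pair and the Drude atom: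
`WindowDecomposition ∧ NoDrudeWeight ⇒ LinearCeiling ⇒ NoDrudeWeight` (the first arrow is
`linearCeiling_of_windowDecomposition_of_noDrudeWeight`, p172217). In particular the crux is AT LEAST the
zero-energy-Drude-weight problem of the infinite deterministic anharmonic chain (Mazur–Suzuki: no conserved quantity
overlaps the energy current), itself open.

[cite: BonettoLebowitzReyBellet2000, §7 eq. (37)] [cite: Mazur1969] [cite: Helfand1960, §II]
-/

noncomputable section

namespace Summit.AtomisticToContinuum.FouriersLaw.Theorems.LinearCeiling.SpikeLemma

open MeasureTheory Filter Set
open scoped Topology BigOperators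
open Literature.MathematicalPhysics.KineticTheory.HeatConduction
open Summit.AtomisticToContinuum.FouriersLaw.Theses.CoercivePulse (LinearCeiling)
open Summit.AtomisticToContinuum.FouriersLaw.Theses.LatticeLandauDamping (NoDrudeWeight)

/-! ### Pure real analysis: Abel means of a cosine transform bound the spectral mass near zero -/

/-- **Atom bound.** If `C(t) = ∫ cos(ωt) dσ(ω)` for a finite measure `σ` on `ℝ` and the Abel mean at `ν > 0`
satisfies `∫₀^∞ e^{−νt} C(t) dt ≤ B`, then `σ{0} ≤ B·ν`: by Fubini the Abel mean is the Poisson integral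
`∫ ν/(ν²+ω²) dσ(ω)`, and the kernel equals `1/ν` at `ω = 0`. [folklore] -/
theorem measureReal_singleton_zero_le_of_abelMean_le (σ : Measure ℝ) [IsFiniteMeasure σ] (C : ℝ → ℝ)
    (hC : ∀ t : ℝ, C t = ∫ ω, Real.cos (ω * t) ∂σ) {ν B : ℝ} (hν : 0 < ν)
    (hA : ∫ t in Ioi (0:ℝ), Real.exp (-(ν * t)) * C t ≤ B) :
    σ.real {0} ≤ B * ν := by
  have h1 : ∫ t in Ioi (0:ℝ), Real.exp (-(ν * t)) * C t = ∫ ω, ν / (ν ^ 2 + ω ^ 2) ∂σ := by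
    rw [show (fun t => Real.exp (-(ν * t)) * C t) = fun t => Real.exp (-(ν * t)) * ∫ ω, Real.cos (ω * t) ∂σ from
      funext fun t => by rw [hC t]]
    exact Summit.AtomisticToContinuum.FouriersLaw.Theorems.AbelOfSpectralDensity.integral_exp_neg_mul_cosTransform σ hν
  have h2 : ∫ ω, Set.indicator {(0:ℝ)} (fun _ => ν⁻¹) ω ∂σ ≤ ∫ ω, ν / (ν ^ 2 + ω ^ 2) ∂σ := by
    refine integral_mono ((integrable_const _).indicator (measurableSet_singleton 0))
      (GreenKuboContinuation.BandLimitedKrylov.FilterInvariance.integrable_poisson σ hν) fun ω => ?_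
    by_cases hω : ω = 0
    · subst hω
      rw [Set.indicator_of_mem (Set.mem_singleton _)]
      rw [show ν / (ν ^ 2 + (0:ℝ) ^ 2) = ν⁻¹ by
        rw [zero_pow two_ne_zero, add_zero, pow_two, div_mul_eq_div_div, div_self hν.ne', one_div]]
    · rw [Set.indicator_of_notMem (by simpa using hω)]
      positivity
  have h3 : ∫ ω, Set.indicator {(0:ℝ)} (fun _ => ν⁻¹) ω ∂σ = σ.real {0} * ν⁻¹ := by
    rw [integral_indicator (measurableSet_singleton 0), setIntegral_const, smul_eq_mul]
  have h4 : σ.real {0} * ν⁻¹ ≤ B := by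
    rw [← h3]
    exact h2.trans (h1 ▸ hA)
  rwa [← div_eq_mul_inv, div_le_iff₀ hν] at h4

/-- **An Abel ceiling kills the atom at zero.** If `C(t) = ∫ cos(ωt) dσ(ω)` for a finite measure `σ` and
`∫₀^∞ e^{−νt} C(t) dt ≤ B` for all `ν ∈ (0, ν₀)`, then `σ{0} = 0` (`σ{0} ≤ Bν → 0`). [folklore] -/
theorem measure_singleton_zero_eq_zero_of_abelCeiling (σ : Measure ℝ) [IsFiniteMeasure σ] (C : ℝ → ℝ)
    (hC : ∀ t : ℝ, C t = ∫ ω, Real.cos (ω * t) ∂σ) {B ν₀ : ℝ} (hν₀ : 0 < ν₀)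
    (hA : ∀ ν : ℝ, 0 < ν → ν < ν₀ → ∫ t in Ioi (0:ℝ), Real.exp (-(ν * t)) * C t ≤ B) :
    σ {0} = 0 := by
  have key : ∀ᶠ ν in 𝓝[>] (0:ℝ), σ.real {0} ≤ B * ν := by
    have hν₀' : ∀ᶠ ν in 𝓝[>] (0:ℝ), ν < ν₀ := nhdsWithin_le_nhds (Iio_mem_nhds hν₀)
    filter_upwards [self_mem_nhdsWithin, hν₀'] with ν hν hν'
    exact measureReal_singleton_zero_le_of_abelMean_le σ C hC hν (hA ν hν hν')
  have hlim : Tendsto (fun ν : ℝ => B * ν) (𝓝[>] (0:ℝ)) (𝓝 0) := by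
    have h : Tendsto (fun ν : ℝ => B * ν) (𝓝 (0:ℝ)) (𝓝 (B * 0)) :=
      (continuous_const.mul continuous_id).tendsto 0
    rw [mul_zero] at h
    exact h.mono_left nhdsWithin_le_nhds
  have h0 : σ.real {0} ≤ 0 := ge_of_tendsto hlim key
  have h0' : σ.real {0} = 0 := le_antisymm h0 measureReal_nonneg
  exact (measureReal_eq_zero_iff (measure_ne_top σ _)).1 h0'

/-! ### The chain: `LinearCeiling` kills the energy Drude weight -/

/-- **(AC) ⇒ `NoDrudeWeight`.** If the Abel means of the summed current autocorrelation of every guarded pair of the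
pinned anharmonic chain are bounded above on some `(0, ν₀)`, then every cosine-Bochner spectral measure of the
current autocorrelation of a shift-invariant DLR state with a preserving dynamics has no atom at zero frequency
(`LatticeLandauDamping.NoDrudeWeight`, item stmt-AtomisticToContinuum-14012). The state is momentum-reversal
invariant by DLR uniqueness in the shift-invariant class (`Negative.map_reversal_eq_of_gibbs_shiftInvariant`).
[cite: BonettoLebowitzReyBellet2000, §7 eq. (37)] [cite: Mazur1969] -/
theorem noDrudeWeight_of_abelCeiling
    (hAC : ∀ ω₂ lam β γ : ℝ, 0 < ω₂ → 0 < lam → 0 < β → ∀ T : ℝ, 0 < T →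
      ∀ μ : MeasureTheory.Measure ChainConfig, (pinnedChain ω₂ lam β γ).IsChainGibbsMeasure T μ →
      IsShiftInvariant μ → μ.map (fun σ : ChainConfig => fun x : ℤ => ((σ x).1, -(σ x).2)) = μ →
      ∀ D : InfiniteChainDynamics (pinnedChain ω₂ lam β γ), D.PreservesMeasure μ →
      ∃ B ν₀ : ℝ, 0 < ν₀ ∧ ∀ ν : ℝ, 0 < ν → ν < ν₀ →
        ∫ t in Set.Ioi (0:ℝ), Real.exp (-(ν * t)) * D.currentCorrelation μ t ≤ B) :
    NoDrudeWeight := by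
  intro ω₂ lam β γ hω hl hβ _hγ T hT μT D hG hShift hP _hAbs σ hσfin hcos
  have hSI : IsShiftInvariant μT := (hShift 1).map_eq
  have hRev : μT.map (fun σ : ChainConfig => fun x : ℤ => ((σ x).1, -(σ x).2)) = μT :=
    Summit.AtomisticToContinuum.FouriersLaw.Theorems.LinearCeiling.Negative.map_reversal_eq_of_gibbs_shiftInvariant
      γ hω hl.le hβ.le hT hG hSI
  obtain ⟨B, ν₀, hν₀, hA⟩ := hAC ω₂ lam β γ hω hl hβ T hT μT hG hSI hRev D hP
  exact measure_singleton_zero_eq_zero_of_abelCeiling σ (D.currentCorrelation μT) hcos hν₀ hA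

/-- **`LinearCeiling ⇒ NoDrudeWeight`** (close-on-close certificate: closing stmt-AtomisticToContinuum-15383 closes
stmt-AtomisticToContinuum-14012). The diffusive upper envelope of the Helfand moment of the averaged energy pulse of
the pinned anharmonic chain forces the energy Drude weight (the atom at zero frequency of the current spectral
measure) to vanish: `LinearCeiling ⇒ (AC)` (`abelCeiling_of_linearCeiling`, via the proved `PulseCalculus`) and an
Abel ceiling kills the atom. [cite: Helfand1960, §II] [cite: Mazur1969] -/
theorem noDrudeWeight_of_linearCeiling (hLC : LinearCeiling) : NoDrudeWeight :=
  noDrudeWeight_of_abelCeiling (abelCeiling_of_linearCeiling hLC)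

end Summit.AtomisticToContinuum.FouriersLaw.Theorems.LinearCeiling.SpikeLemma

end
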